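import Mathlib
import HarnessLib
import Summits.HubbardSuperconductivity.HubbardSuperconductivity.Theorems.KLProgrammeKLRegimeSplitPredicatesV3

/-!
# Route `KLProgramme` — crux K3 split, child 1 `KLRegimeBetaSplit(V3/V4)`: the two one-line closers of the supplier map
# ((B4) ⇐ (E4) and (B2-iso) ⇐ (E5-v3) given a value bound; cell gate-hubbard-kl, seat p1 = C1 lead, g5)

For the split slot of record `BetaSplitAtV3 = PairArrayAt ∧ EndpointLineV3 ∧ FirstMoments` (`KLProgrammeKLRegimeSplitPredicatesV3`):
* `firstMoments_of_engineFirstMoments`: (E4) `EngineFirstMoments G P Q … n` gives (B4) `FirstMoments P … n` as soon as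
  `G.cE4 + Q.cE4·|U| ≤ P.Cd` (child 1 takes `P.Cd := G.cE4 + 1` and `U₀ ≤ 1/Q.cE4`);
* `endpointNormLineIso_of_isoTupleL1At`: (E5-v3) `IsoTupleL1At G P … n` with ANY value bound `B` on the ball gives the isotropic endpoint line
  (B2-iso) `EndpointNormLineIso P … n` as soon as `G.CF·B + G.CF·(P.Klam·U)² ≤ P.Klam·|U|` — the arithmetic side condition child 1 meets with
  the SHARP bound `B = 2|U| + C′U²` it derives from the history's engine clauses (NOT with the value line's `Klam|U|`, which would ask `Klam ≥ CF·Klam`;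
  HOME/STATUS p1 Δ11) and `P.Klam := 2·G.CF + 1`, `U₀` small.
Pure bookkeeping; nothing about the model is asserted.
-/

noncomputable section

namespace Summit.HubbardSuperconductivity.HubbardSuperconductivity.Theorems.KLRegimeSplit

set_option linter.dupNamespace false -- summit = problem name (single-conjunct summit), D-0017

open Real Finset Literature.MathematicalPhysics.QuantumLattice Literature.Probability.LatticeModels
open Summit.HubbardSuperconductivity.HubbardSuperconductivity.Theorems.KLProgrammeLegKernels

section Model

variable (L M : ℕ) [NeZero L] [NeZero M]

/-- **(B4) ⇐ (E4)**: the engine's first moments give child 1's first-moment line once `G.cE4 + Q.cE4·|U| ≤ P.Cd`. -/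
theorem firstMoments_of_engineFirstMoments {G : GeoConsts} {P : SplitConsts} {Q : EngConsts} {β U μ : ℝ} {K : TrigPolyC4v}
    {n : ℕ} (hP : 0 ≤ P.Klam) (hCd : G.cE4 + Q.cE4 * |U| ≤ P.Cd) (h : EngineFirstMoments L M G P Q β U μ K n) :
    FirstMoments L M P β U μ K n := by
  intro Ω i k
  refine (h Ω i k).trans ?_
  have h4 : (0 : ℝ) ≤ (4 : ℝ) ^ n := by positivity
  have : (G.cE4 + Q.cE4 * |U|) * P.Klam * |U| * (4 : ℝ) ^ n ≤ P.Cd * P.Klam * |U| * (4 : ℝ) ^ n :=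
    mul_le_mul_of_nonneg_right (mul_le_mul_of_nonneg_right (mul_le_mul_of_nonneg_right hCd hP) (abs_nonneg U)) h4
  exact this

/-- **(B2-iso) ⇐ (E5-v3) + a value bound**: if the running coupling values at scale `n` are bounded by `B ≥ 0` on the ball and
`CF·B + CF·(Klam U)² ≤ Klam·|U|`, the engine's values-to-`L¹` clause gives the isotropic endpoint norm line at scale `n` (read at the
scale's own resolution `m = n`: `klIsoKernelAt … n n = klLegKernel … n 4`). -/
theorem endpointNormLineIso_of_isoTupleL1At {G : GeoConsts} {P : SplitConsts} {β U μ : ℝ} {K : TrigPolyC4v} {n : ℕ} {B : ℝ}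
    (hB : 0 ≤ B)
    (hval : ∀ (σ σ' : Fin 2), ∀ k₁ ∈ klBall L μ K, ∀ k₂ ∈ klBall L μ K, ∀ k₃ ∈ klBall L μ K,
      ‖klQuarticValue L M β U μ K n σ σ' k₁ k₂ k₃‖ ≤ B)
    (harith : G.CF * B + G.CF * (P.Klam * U) ^ 2 ≤ P.Klam * |U|) (h : IsoTupleL1At L M G P β U μ K n) :
    EndpointNormLineIso L M P β U μ K n := by
  intro Ω hΩ x₁
  have h' := h B hB hval n le_rfl Ω hΩ x₁
  rw [klIsoKernelAt_self] at h'
  exact h'.trans harith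

/-- **`EndpointLineV3` assembled**: the isotropic line (from (E5-v3) with the sharp bound `B`) and the value line (from any bound
`B ≤ Klam·|U|` on the values) together. -/
theorem endpointLineV3_of {G : GeoConsts} {P : SplitConsts} {β U μ : ℝ} {K : TrigPolyC4v} {n : ℕ} {B : ℝ} (hB : 0 ≤ B)
    (hval : ∀ (σ σ' : Fin 2), ∀ k₁ ∈ klBall L μ K, ∀ k₂ ∈ klBall L μ K, ∀ k₃ ∈ klBall L μ K,
      ‖klQuarticValue L M β U μ K n σ σ' k₁ k₂ k₃‖ ≤ B)
    (hBK : B ≤ P.Klam * |U|) (harith : G.CF * B + G.CF * (P.Klam * U) ^ 2 ≤ P.Klam * |U|)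
    (h : IsoTupleL1At L M G P β U μ K n) : EndpointLineV3 L M P β U μ K n :=
  ⟨endpointNormLineIso_of_isoTupleL1At L M hB hval harith h,
    fun σ σ' k₁ hk₁ k₂ hk₂ k₃ hk₃ => (hval σ σ' k₁ hk₁ k₂ hk₂ k₃ hk₃).trans hBK⟩

/-- The arithmetic side condition is met by `Klam := 2·CF + 1` for `B = 2|U| + C′U²` and `U` small:
if `Klam = 2·CF + 1` and `CF·(C′ + Klam²)·|U| ≤ 1` then `CF·(2|U| + C′U²) + CF·(Klam U)² ≤ Klam·|U|`. -/
theorem klam_arith {CF C' Klam U : ℝ} (hK : Klam = 2 * CF + 1) (hU : CF * (C' + Klam ^ 2) * |U| ≤ 1) :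
    CF * (2 * |U| + C' * U ^ 2) + CF * (Klam * U) ^ 2 ≤ Klam * |U| := by
  have ha : 0 ≤ |U| := abs_nonneg U
  have hsq : (Klam * U) ^ 2 = Klam ^ 2 * |U| ^ 2 := by rw [mul_pow, sq_abs]
  have hU2 : U ^ 2 = |U| ^ 2 := (sq_abs U).symm
  rw [hsq, hU2]
  have hkey : CF * (C' + Klam ^ 2) * |U| * |U| ≤ 1 * |U| := mul_le_mul_of_nonneg_right hU ha
  have hexp : CF * (2 * |U| + C' * |U| ^ 2) + CF * (Klam ^ 2 * |U| ^ 2) =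
      2 * CF * |U| + CF * (C' + Klam ^ 2) * |U| * |U| := by ring
  rw [hexp]
  have hKU : Klam * |U| = 2 * CF * |U| + |U| := by rw [hK]; ring
  linarith

end Model

end Summit.HubbardSuperconductivity.HubbardSuperconductivity.Theorems.KLRegimeSplit

end
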